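import Summits.ValiantsHypothesis.ValiantsHypothesis.Theorems.BarrierLeverPartitionMinorsHitByVPTwoBlockTropical

/-!
# Route BarrierLever — the PAIR MOVE of the priority-peeling calculus for TT (item 19152 / core 19616)

Helper file (`--supports stmt-ValiantsHypothesis-19152`; cell valiant-natproofs, rung V4, 𝒟-side;
prover gen 7; memo `HOME/prover/gen7/PP-MEMO-g7.md` §1/§5: in machine search this move, with shears,
certifies every tested TT layout incl. the whole R1/R2-irreducible core of item 19616 at `h = 3`).
**Setting.** `G` has rows `Fin nr` (row literals) and columns `Fin nc` (column literals); a
CONFIGURATION is a family of row index maps `R i : Fin (d+1) → Fin nr` and column index maps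
`C j : Fin (d+1) → Fin nc` (`i, j : Fin r`; for a TT layout they enumerate the literals of `u_i`,
`w_j` in sorted order — no monotonicity is needed here); its layout matrix is `(det G[R i, C j])_{ij}`
and it is ALIVE if that determinant is nonzero for some `G`.
**The pair move (`pairMove`).** Row literals `ℓ₀ ≠ ℓ₁`, each `R i` hitting exactly one of them (at
position `pos i`, `β i` says which); sets `P`, `S` of column literals, a weight `w`; group bits
`grp j`: group-`false` columns meet `P` and `qφ j` is the position of the unique `w`-maximal element
of `C j ∩ P`, group-`true` columns avoid `P`, meet `S`, and `qφ j` is the position of the unique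
`w`-maximal element of `C j ∩ S`; a permutation `f` matching the rows hitting `ℓ₀` with the
group-`false` columns (BALANCE `#I₀ = #J₀`). Children: delete `pos i` from `R i` and `qφ j` from
`C j` (`Fin.succAbove`). CLAIM: if ONE `G'` makes both children's layout matrices nonsingular, some
`G` makes the parent's nonsingular. PROOF: over `ℂ[X]` take row `ℓ₀ := Σ_{m∈P} X^{w m} e_m`, row
`ℓ₁ := Σ_{m∈S} X^{w m} e_m`, other rows `G'`; the layout matrix is block-triangular along `f`
(`Matrix.twoBlockTriangular_det'`), each diagonal-block entry is, by Laplace along the row of `ℓ_β`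
(`Matrix.det_succ_row`), a polynomial of degree `≤ w(φ j)` with top coefficient `± det(child entry)`,
so the top coefficient of the block determinant is `±` the child determinant
(`coeff_det_of_natDegree_le_col`); a nonzero complex polynomial has a non-root. `P, S` inside ONE
column pair = R1 / P3 (item 19587) and the dimension reduction; ACROSS pairs = the new cross move
(parity-locked layouts, e.g. square × claw, TNS-calculus-g8 §6.3). Shear move / recursion: not here.

WHAT THIS IS NOT: one reduction step, kernel-checked; no claim that pair-move certificates exist for
every layout (memo §4: they do for every layout tested, h ≤ 6); nothing on TT / TNS / item 19717 in
general, on crux stmt-ValiantsHypothesis-14610, or on `VP` versus `VNP`.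
-/

-- layout Summits/ValiantsHypothesis/ValiantsHypothesis forces the duplicated namespace component
set_option linter.dupNamespace false

namespace Summit.ValiantsHypothesis.ValiantsHypothesis.Theorems.BarrierLever.PriorityPeeling

open Finset Polynomial Matrix

/-! ## 1. Column-degree leading coefficient of a determinant -/
/-- If every entry of column `j` of `N ∈ M(ℂ[X])` has degree `≤ b j`, the coefficient of
`X^{Σ_j b j}` in `det N` is the determinant of the matrix of `X^{b j}`-coefficients. -/
theorem coeff_det_of_natDegree_le_col {ι : Type*} [Fintype ι] [DecidableEq ι]
    (N : Matrix ι ι ℂ[X]) (b : ι → ℕ) (hN : ∀ i j, (N i j).natDegree ≤ b j) :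
    (det N).coeff (∑ j, b j) = det (Matrix.of fun i j => (N i j).coeff (b j)) := by
  rw [det_apply, det_apply, finsetSum_coeff]
  refine Finset.sum_congr rfl fun σ _ => ?_
  rw [coeff_smul, TwoBlock.coeff_prod_of_natDegree_le_sum (s := Finset.univ)
    (f := fun i => N (σ i) i) (n := b) (fun i _ => hN (σ i) i)]
  rfl

/-! ## 2. One entry: Laplace expansion along a sparse monomial row -/
section Entry

variable {d : ℕ}

/- The «sparse-row matrix» of `(B, p, T, e)`: row `p` is `q ↦ [T q] · X^{e q}`, the other rows
are the constants `B` (written out in full in every statement; no definition is introduced). -/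

/-- Laplace expansion of `sparseRowMatrix` along the sparse row. -/
theorem det_sparseRowMatrix (B : Matrix (Fin (d + 1)) (Fin (d + 1)) ℂ) (p : Fin (d + 1))
    (T : Fin (d + 1) → Prop) [DecidablePred T] (e : Fin (d + 1) → ℕ) :
    (Matrix.of fun i' q' => if i' = p then (if T q' then X ^ (e q') else 0) else C (B i' q') :
      Matrix (Fin (d + 1)) (Fin (d + 1)) ℂ[X]).det = ∑ q : Fin (d + 1), if T q then
      C ((-1 : ℂ) ^ ((p : ℕ) + (q : ℕ)) * (B.submatrix p.succAbove q.succAbove).det) * X ^ (e q)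
      else 0 := by
  rw [Matrix.det_succ_row _ p]
  refine Finset.sum_congr rfl fun q _ => ?_
  have hsub : (Matrix.of fun i' q' => if i' = p then (if T q' then X ^ (e q') else 0) else C (B i' q') :
      Matrix (Fin (d + 1)) (Fin (d + 1)) ℂ[X]).submatrix p.succAbove q.succAbove =
      (B.submatrix p.succAbove q.succAbove).map C := by
    ext a b
    simp only [Matrix.submatrix_apply, Matrix.map_apply, Matrix.of_apply,
      if_neg (Fin.succAbove_ne p a)]
  have hrow : (Matrix.of fun i' q' => if i' = p then (if T q' then X ^ (e q') else 0) else C (B i' q') :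
      Matrix (Fin (d + 1)) (Fin (d + 1)) ℂ[X]) p q = if T q then X ^ (e q) else 0 := by
    simp only [Matrix.of_apply, if_true]
  rw [hsub, hrow]
  have hdet : ((B.submatrix p.succAbove q.succAbove).map C).det =
      C ((B.submatrix p.succAbove q.succAbove).det) :=
    (RingHom.map_det (C : ℂ →+* ℂ[X]) _).symm
  rw [hdet]
  split_ifs with hq
  · rw [map_mul, map_pow, map_neg, map_one]
    ring
  · simp

/-- Degree bound: if the exponents on the support are `≤ E`, the determinant has degree `≤ E`. -/
theorem natDegree_det_sparseRowMatrix_le (B : Matrix (Fin (d + 1)) (Fin (d + 1)) ℂ)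
    (p : Fin (d + 1)) (T : Fin (d + 1) → Prop) [DecidablePred T] (e : Fin (d + 1) → ℕ) (E : ℕ)
    (hE : ∀ q, T q → e q ≤ E) : ((Matrix.of fun i' q' => if i' = p then (if T q' then X ^ (e q') else 0) else C (B i' q') :
      Matrix (Fin (d + 1)) (Fin (d + 1)) ℂ[X]).det).natDegree ≤ E := by
  rw [det_sparseRowMatrix]
  refine natDegree_sum_le_of_forall_le _ _ (fun q _ => ?_)
  split_ifs with hq
  · exact (natDegree_C_mul_X_pow_le _ _).trans (hE q hq)
  · simp

/-- Top coefficient: if `q₀` is in the support and carries the STRICTLY largest exponent, the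
coefficient of `X^{e q₀}` is `(−1)^{p+q₀} · det` of the complementary constant minor. -/
theorem coeff_det_sparseRowMatrix_top (B : Matrix (Fin (d + 1)) (Fin (d + 1)) ℂ)
    (p : Fin (d + 1)) (T : Fin (d + 1) → Prop) [DecidablePred T] (e : Fin (d + 1) → ℕ)
    (q₀ : Fin (d + 1)) (hq₀ : T q₀) (htop : ∀ q, T q → q ≠ q₀ → e q < e q₀) :
    ((Matrix.of fun i' q' => if i' = p then (if T q' then X ^ (e q') else 0) else C (B i' q') :
      Matrix (Fin (d + 1)) (Fin (d + 1)) ℂ[X]).det).coeff (e q₀) =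
      (-1 : ℂ) ^ ((p : ℕ) + (q₀ : ℕ)) * (B.submatrix p.succAbove q₀.succAbove).det := by
  rw [det_sparseRowMatrix, finsetSum_coeff, Finset.sum_eq_single q₀]
  · rw [if_pos hq₀, coeff_C_mul_X_pow, if_pos rfl]
  · intro q _ hq
    split_ifs with hTq
    · rw [coeff_C_mul_X_pow, if_neg (Nat.ne_of_gt (htop q hTq hq))]
    · simp
  · intro h
    exact absurd (Finset.mem_univ q₀) h

/-- Zero row: if the support is empty the determinant vanishes. -/
theorem det_sparseRowMatrix_of_empty (B : Matrix (Fin (d + 1)) (Fin (d + 1)) ℂ)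
    (p : Fin (d + 1)) (T : Fin (d + 1) → Prop) [DecidablePred T] (e : Fin (d + 1) → ℕ)
    (hT : ∀ q, ¬ T q) : (Matrix.of fun i' q' => if i' = p then (if T q' then X ^ (e q') else 0) else C (B i' q') :
      Matrix (Fin (d + 1)) (Fin (d + 1)) ℂ[X]).det = 0 := by
  rw [det_sparseRowMatrix]
  refine Finset.sum_eq_zero (fun q _ => ?_)
  rw [if_neg (hT q)]

end Entry

section Specialise

variable {nr nc : ℕ}

/- The «specialised matrix» of `(G', ℓ₀, ℓ₁, P, S, w)`: row `ℓ₀ = Σ_{m∈P} X^{w m} e_m`, row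
`ℓ₁ = Σ_{m∈S} X^{w m} e_m`, every other row the constant row of `G'` (written out in full). -/

variable {d : ℕ}

/-- A minor of the specialised matrix whose row map hits `ℓ₀` exactly at position `p` (and avoids
`ℓ₁`) is a `sparseRowMatrix` with support `{q : C q ∈ P}`. -/
theorem submatrix_specialise_eq₀ (G' : Matrix (Fin nr) (Fin nc) ℂ) (ℓ₀ ℓ₁ : Fin nr)
    (P S : Finset (Fin nc)) (w : Fin nc → ℕ) (ρ : Fin (d + 1) → Fin nr) (κ : Fin (d + 1) → Fin nc)
    (p : Fin (d + 1)) (hp : ρ p = ℓ₀) (hρ₀ : ∀ a, a ≠ p → ρ a ≠ ℓ₀) (hρ₁ : ∀ a, ρ a ≠ ℓ₁) :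
    (Matrix.of fun x m => if x = ℓ₀ then (if m ∈ P then X ^ (w m) else 0)
      else if x = ℓ₁ then (if m ∈ S then X ^ (w m) else 0) else Polynomial.C (G' x m) :
      Matrix (Fin nr) (Fin nc) ℂ[X]).submatrix ρ κ =
      (Matrix.of fun i' q' => if i' = p then (if (fun q => κ q ∈ P) q' then X ^ ((fun q => w (κ q)) q') else 0) else C ((G'.submatrix ρ κ) i' q') :
      Matrix (Fin (d + 1)) (Fin (d + 1)) ℂ[X]) := by
  ext a q
  simp only [Matrix.submatrix_apply, Matrix.of_apply]
  by_cases ha : a = p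
  · subst ha
    rw [if_pos hp, if_pos rfl]
  · rw [if_neg (hρ₀ a ha), if_neg (hρ₁ a), if_neg ha]

/-- The same for a row map hitting `ℓ₁` exactly at position `p` (and avoiding `ℓ₀`): support
`{q : C q ∈ S}`. -/
theorem submatrix_specialise_eq₁ (G' : Matrix (Fin nr) (Fin nc) ℂ) (ℓ₀ ℓ₁ : Fin nr)
    (P S : Finset (Fin nc)) (w : Fin nc → ℕ) (ρ : Fin (d + 1) → Fin nr) (κ : Fin (d + 1) → Fin nc)
    (p : Fin (d + 1)) (hp : ρ p = ℓ₁) (hρ₁ : ∀ a, a ≠ p → ρ a ≠ ℓ₁) (hρ₀ : ∀ a, ρ a ≠ ℓ₀) :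
    (Matrix.of fun x m => if x = ℓ₀ then (if m ∈ P then X ^ (w m) else 0)
      else if x = ℓ₁ then (if m ∈ S then X ^ (w m) else 0) else Polynomial.C (G' x m) :
      Matrix (Fin nr) (Fin nc) ℂ[X]).submatrix ρ κ =
      (Matrix.of fun i' q' => if i' = p then (if (fun q => κ q ∈ S) q' then X ^ ((fun q => w (κ q)) q') else 0) else C ((G'.submatrix ρ κ) i' q') :
      Matrix (Fin (d + 1)) (Fin (d + 1)) ℂ[X]) := by
  ext a q
  simp only [Matrix.submatrix_apply, Matrix.of_apply]
  by_cases ha : a = p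
  · subst ha
    rw [if_neg (hρ₀ a), if_pos hp, if_pos rfl]
  · rw [if_neg (hρ₀ a), if_neg (hρ₁ a ha), if_neg ha]

end Specialise

section PairMove

variable {nr nc r d : ℕ}

/-- A boolean that is not `false` is `true`. -/
theorem bool_eq_true_of_not_eq_false {b : Bool} (h : ¬ b = false) : b = true := by
  cases b <;> simp_all

/-- Scaling by signs `(−1)^{a i + b j}` keeps a determinant nonzero. -/
theorem det_signs_ne_zero {ι : Type*} [Fintype ι] [DecidableEq ι] (Y : Matrix ι ι ℂ)
    (a b : ι → ℕ) (hY : Y.det ≠ 0) :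
    (Matrix.of fun i j => (-1 : ℂ) ^ (a i + b j) * Y i j).det ≠ 0 := by
  have h1 : (Matrix.of fun i j => (-1 : ℂ) ^ (a i + b j) * Y i j) =
      Matrix.of fun i j => (-1 : ℂ) ^ a i *
        ((Matrix.of fun i' j' => (-1 : ℂ) ^ b j' * Y i' j') i j) := by
    ext i j
    simp only [Matrix.of_apply, pow_add]
    ring
  rw [h1, Matrix.det_mul_column, Matrix.det_mul_row]
  refine mul_ne_zero ?_ (mul_ne_zero ?_ hY)
  · exact Finset.prod_ne_zero_iff.mpr fun i _ => pow_ne_zero _ (neg_ne_zero.mpr one_ne_zero)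
  · exact Finset.prod_ne_zero_iff.mpr fun i _ => pow_ne_zero _ (neg_ne_zero.mpr one_ne_zero)

/-- **Diagonal block lemma.** Rows hitting `ℓ₀` at `pos i` (avoiding `ℓ₁`), columns whose
`P`-support has the unique `w`-maximal position `qφ j`: the block of minors of the specialised
matrix has nonzero determinant (as a polynomial) once the block of CHILD minors of `G'` is
nonsingular. (The `ℓ₁ / S` case follows by `specialise_swap`.) -/
theorem det_block_ne_zero {ι : Type*} [Fintype ι] [DecidableEq ι]
    (G' : Matrix (Fin nr) (Fin nc) ℂ) (ℓ₀ ℓ₁ : Fin nr) (P S : Finset (Fin nc)) (w : Fin nc → ℕ)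
    (ρ : ι → Fin (d + 1) → Fin nr) (κ : ι → Fin (d + 1) → Fin nc) (pos qφ : ι → Fin (d + 1))
    (hpos : ∀ i, ρ i (pos i) = ℓ₀) (hρ₀ : ∀ i a, a ≠ pos i → ρ i a ≠ ℓ₀) (hρ₁ : ∀ i a, ρ i a ≠ ℓ₁)
    (hφ : ∀ j, κ j (qφ j) ∈ P) (htop : ∀ j q, κ j q ∈ P → q ≠ qφ j → w (κ j q) < w (κ j (qφ j)))
    (hchild : (Matrix.of fun i j : ι =>
      (G'.submatrix (ρ i ∘ (pos i).succAbove) (κ j ∘ (qφ j).succAbove)).det).det ≠ 0) :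
    (Matrix.of fun i j : ι => ((Matrix.of fun x m => if x = ℓ₀ then (if m ∈ P then X ^ (w m) else 0)
      else if x = ℓ₁ then (if m ∈ S then X ^ (w m) else 0) else Polynomial.C (G' x m) :
      Matrix (Fin nr) (Fin nc) ℂ[X]).submatrix (ρ i) (κ j)).det).det ≠ 0 := by
  set N : Matrix ι ι ℂ[X] :=
    Matrix.of fun i j : ι => ((Matrix.of fun x m => if x = ℓ₀ then (if m ∈ P then X ^ (w m) else 0)
      else if x = ℓ₁ then (if m ∈ S then X ^ (w m) else 0) else Polynomial.C (G' x m) :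
      Matrix (Fin nr) (Fin nc) ℂ[X]).submatrix (ρ i) (κ j)).det with hN_def
  have hentry : ∀ i j, N i j = (Matrix.of fun i' q' => if i' = (pos i) then (if (fun q => κ j q ∈ P) q' then X ^ ((fun q => w (κ j q)) q') else 0) else C ((G'.submatrix (ρ i) (κ j)) i' q') :
      Matrix (Fin (d + 1)) (Fin (d + 1)) ℂ[X]).det := by
    intro i j
    rw [hN_def, Matrix.of_apply, submatrix_specialise_eq₀ G' ℓ₀ ℓ₁ P S w (ρ i) (κ j) (pos i)
      (hpos i) (hρ₀ i) (hρ₁ i)]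
  -- column-wise degree bounds and top coefficients
  have hdeg : ∀ i j, (N i j).natDegree ≤ w (κ j (qφ j)) := by
    intro i j
    rw [hentry]
    refine natDegree_det_sparseRowMatrix_le _ _ _ _ _ (fun q hq => ?_)
    by_cases hq' : q = qφ j
    · rw [hq']
    · exact (htop j q hq hq').le
  have hcoeff : ∀ i j, (N i j).coeff (w (κ j (qφ j))) = (-1 : ℂ) ^ ((pos i : ℕ) + (qφ j : ℕ)) *
      (G'.submatrix (ρ i ∘ (pos i).succAbove) (κ j ∘ (qφ j).succAbove)).det := by
    intro i j
    rw [hentry, coeff_det_sparseRowMatrix_top _ _ _ _ (qφ j) (hφ j) (htop j)]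
    rfl
  intro hzero
  have hc := coeff_det_of_natDegree_le_col N (fun j => w (κ j (qφ j))) hdeg
  rw [hzero, coeff_zero] at hc
  have hmat : (Matrix.of fun i j => (N i j).coeff (w (κ j (qφ j)))) =
      Matrix.of fun i j => (-1 : ℂ) ^ ((pos i : ℕ) + (qφ j : ℕ)) *
        (Matrix.of fun i' j' : ι =>
          (G'.submatrix (ρ i' ∘ (pos i').succAbove) (κ j' ∘ (qφ j').succAbove)).det) i j := by
    ext i j
    simp only [Matrix.of_apply, hcoeff]
  rw [hmat] at hc
  exact det_signs_ne_zero _ (fun i => (pos i : ℕ)) (fun j => (qφ j : ℕ)) hchild hc.symm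

/-- Swapping the roles of `(ℓ₀, P)` and `(ℓ₁, S)`. -/
theorem specialise_swap (G' : Matrix (Fin nr) (Fin nc) ℂ) (ℓ₀ ℓ₁ : Fin nr) (hℓ : ℓ₀ ≠ ℓ₁)
    (P S : Finset (Fin nc)) (w : Fin nc → ℕ) :
    (Matrix.of fun x m => if x = ℓ₁ then (if m ∈ S then X ^ (w m) else 0)
      else if x = ℓ₀ then (if m ∈ P then X ^ (w m) else 0) else Polynomial.C (G' x m) :
      Matrix (Fin nr) (Fin nc) ℂ[X]) =
    (Matrix.of fun x m => if x = ℓ₀ then (if m ∈ P then X ^ (w m) else 0)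
      else if x = ℓ₁ then (if m ∈ S then X ^ (w m) else 0) else Polynomial.C (G' x m) :
      Matrix (Fin nr) (Fin nc) ℂ[X]) := by
  ext x m
  simp only [Matrix.of_apply]
  by_cases h0 : x = ℓ₀
  · subst h0
    rw [if_neg hℓ, if_pos rfl, if_pos rfl]
  · by_cases h1 : x = ℓ₁
    · subst h1
      rw [if_pos rfl, if_neg h0, if_pos rfl]
    · rw [if_neg h1, if_neg h0, if_neg h0, if_neg h1]

/-- **Zero block.** A row map hitting `ℓ₀` and a column map avoiding `P`: the minor vanishes. -/
theorem minor_eq_zero_of_avoids (G' : Matrix (Fin nr) (Fin nc) ℂ) (ℓ₀ ℓ₁ : Fin nr)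
    (P S : Finset (Fin nc)) (w : Fin nc → ℕ) (ρ κ : Fin (d + 1) → Fin _) (p : Fin (d + 1))
    (hp : ρ p = ℓ₀) (hρ₀ : ∀ a, a ≠ p → ρ a ≠ ℓ₀) (hρ₁ : ∀ a, ρ a ≠ ℓ₁) (hκ : ∀ q, κ q ∉ P) :
    ((Matrix.of fun x m => if x = ℓ₀ then (if m ∈ P then X ^ (w m) else 0)
      else if x = ℓ₁ then (if m ∈ S then X ^ (w m) else 0) else Polynomial.C (G' x m) :
      Matrix (Fin nr) (Fin nc) ℂ[X]).submatrix ρ κ).det = 0 := by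
  rw [submatrix_specialise_eq₀ G' ℓ₀ ℓ₁ P S w ρ κ p hp hρ₀ hρ₁]
  exact det_sparseRowMatrix_of_empty _ _ _ _ hκ

/-- A nonzero polynomial over `ℂ` has a non-root. -/
theorem exists_eval_ne_zero_of_ne_zero (f : ℂ[X]) (hf : f ≠ 0) : ∃ t : ℂ, f.eval t ≠ 0 := by
  obtain ⟨t, ht⟩ := Infinite.exists_notMem_finset f.roots.toFinset
  refine ⟨t, fun h => ht ?_⟩
  rw [Multiset.mem_toFinset, Polynomial.mem_roots hf]
  exact h

/-- **THE PAIR MOVE** (memo PP-MEMO-g7 §1, kernel form). See the module docstring for the data.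
If one matrix `G'` makes both child layout matrices nonsingular, some matrix `G` makes the parent
layout matrix `(det G[R i, C j])_{i,j}` nonsingular. -/
theorem pairMove (R : Fin r → Fin (d + 1) → Fin nr) (C : Fin r → Fin (d + 1) → Fin nc)
    (ℓ₀ ℓ₁ : Fin nr) (hℓ : ℓ₀ ≠ ℓ₁) (β : Fin r → Bool) (pos : Fin r → Fin (d + 1))
    (hpos : ∀ i, R i (pos i) = if β i then ℓ₁ else ℓ₀)
    (huniq : ∀ i a, a ≠ pos i → R i a ≠ ℓ₀ ∧ R i a ≠ ℓ₁)
    (P S : Finset (Fin nc)) (w : Fin nc → ℕ)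
    (grp : Fin r → Bool) (qφ : Fin r → Fin (d + 1))
    (hφ₀ : ∀ j, grp j = false → C j (qφ j) ∈ P ∧
      ∀ q, C j q ∈ P → q ≠ qφ j → w (C j q) < w (C j (qφ j)))
    (hφ₁ : ∀ j, grp j = true → (∀ q, C j q ∉ P) ∧ C j (qφ j) ∈ S ∧
      ∀ q, C j q ∈ S → q ≠ qφ j → w (C j q) < w (C j (qφ j)))
    (f : Equiv.Perm (Fin r)) (hf : ∀ i, β i = grp (f i))
    (hchildren : ∃ G' : Matrix (Fin nr) (Fin nc) ℂ,
      (Matrix.of fun i j : {x : Fin r // β x = false} =>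
        (G'.submatrix (R i ∘ (pos i).succAbove) (C (f j) ∘ (qφ (f j)).succAbove)).det).det ≠ 0 ∧
      (Matrix.of fun i j : {x : Fin r // ¬ β x = false} =>
        (G'.submatrix (R i ∘ (pos i).succAbove) (C (f j) ∘ (qφ (f j)).succAbove)).det).det ≠ 0) :
    ∃ G : Matrix (Fin nr) (Fin nc) ℂ,
      (Matrix.of fun i j : Fin r => (G.submatrix (R i) (C j)).det).det ≠ 0 := by
  obtain ⟨G', h₀, h₁⟩ := hchildren
  -- the specialised polynomial matrix and its layout matrix
  set Gp := (Matrix.of fun x m => if x = ℓ₀ then (if m ∈ P then X ^ (w m) else 0)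
      else if x = ℓ₁ then (if m ∈ S then X ^ (w m) else 0) else Polynomial.C (G' x m) :
      Matrix (Fin nr) (Fin nc) ℂ[X]) with hGp_def
  set Lp : Matrix (Fin r) (Fin r) ℂ[X] :=
    Matrix.of fun i j : Fin r => (Gp.submatrix (R i) (C j)).det with hLp_def
  -- facts about rows
  have hpos₀ : ∀ i, β i = false → R i (pos i) = ℓ₀ := fun i hi => by rw [hpos i, hi]; rfl
  have hpos₁ : ∀ i, ¬ β i = false → R i (pos i) = ℓ₁ := fun i hi => by
    rw [hpos i, (bool_eq_true_of_not_eq_false hi)]; rfl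
  have havoid₀ : ∀ i, β i = false → ∀ a, R i a ≠ ℓ₁ := by
    intro i hi a
    by_cases ha : a = pos i
    · rw [ha, hpos₀ i hi]; exact hℓ
    · exact (huniq i a ha).2
  have havoid₁ : ∀ i, ¬ β i = false → ∀ a, R i a ≠ ℓ₀ := by
    intro i hi a
    by_cases ha : a = pos i
    · rw [ha, hpos₁ i hi]; exact hℓ.symm
    · exact (huniq i a ha).1
  -- (1) block triangularity along f
  have hperm : Lp.det = 0 → (Lp.submatrix id f).det = 0 := fun h => by
    rw [Matrix.det_permute', h, mul_zero]
  have hzero : ∀ i, β i = false → ∀ i', ¬ β i' = false → (Lp.submatrix id f) i i' = 0 := by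
    intro i hi i' hi'
    have hg : grp (f i') = true := by
      have := hf i'
      rw [bool_eq_true_of_not_eq_false hi'] at this
      exact this.symm
    rw [Matrix.submatrix_apply, id_eq, hLp_def, Matrix.of_apply]
    exact minor_eq_zero_of_avoids G' ℓ₀ ℓ₁ P S w (R i) (C (f i')) (pos i) (hpos₀ i hi)
      (fun a ha => (huniq i a ha).1) (havoid₀ i hi) (hφ₁ (f i') hg).1
  have hblock := Matrix.twoBlockTriangular_det' (Lp.submatrix id f) (fun i => β i = false) hzero
  -- (2)+(3) the two diagonal blocks are nonzero polynomials
  have hB₀ : ((Lp.submatrix id f).toSquareBlockProp (fun i => β i = false)).det ≠ 0 := by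
    rw [Matrix.toSquareBlockProp_def]
    have heq : (Matrix.of fun i j : {x : Fin r // β x = false} => (Lp.submatrix id f) ↑i ↑j) =
        Matrix.of fun i j : {x : Fin r // β x = false} =>
          ((Matrix.of fun x m => if x = ℓ₀ then (if m ∈ P then X ^ (w m) else 0)
      else if x = ℓ₁ then (if m ∈ S then X ^ (w m) else 0) else Polynomial.C (G' x m) :
      Matrix (Fin nr) (Fin nc) ℂ[X]).submatrix (R i) (C (f j))).det := by
      refine Matrix.ext (fun i j => ?_)
      rw [Matrix.of_apply, Matrix.of_apply, Matrix.submatrix_apply, id_eq, hLp_def, Matrix.of_apply,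
        hGp_def]
    rw [heq]
    have hg0 : ∀ j : {x : Fin r // β x = false}, grp (f j) = false := by
      intro j
      have := hf j
      rw [j.2] at this
      exact this.symm
    exact det_block_ne_zero (ι := {x : Fin r // β x = false}) G' ℓ₀ ℓ₁ P S w
      (fun i => R i) (fun j => C (f j)) (fun i => pos i) (fun j => qφ (f j))
      (fun i => hpos₀ i i.2) (fun i a ha => (huniq i a ha).1) (fun i => havoid₀ i i.2)
      (fun j => (hφ₀ (f j) (hg0 j)).1) (fun j => (hφ₀ (f j) (hg0 j)).2) h₀
  have hB₁ : ((Lp.submatrix id f).toSquareBlockProp (fun i => ¬ β i = false)).det ≠ 0 := by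
    rw [Matrix.toSquareBlockProp_def]
    have heq : (Matrix.of fun i j : {x : Fin r // ¬ β x = false} => (Lp.submatrix id f) ↑i ↑j) =
        Matrix.of fun i j : {x : Fin r // ¬ β x = false} =>
          ((Matrix.of fun x m => if x = ℓ₁ then (if m ∈ S then X ^ (w m) else 0)
      else if x = ℓ₀ then (if m ∈ P then X ^ (w m) else 0) else Polynomial.C (G' x m) :
      Matrix (Fin nr) (Fin nc) ℂ[X]).submatrix (R i) (C (f j))).det := by
      refine Matrix.ext (fun i j => ?_)
      rw [Matrix.of_apply, Matrix.of_apply, Matrix.submatrix_apply, id_eq, hLp_def, Matrix.of_apply,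
        hGp_def, specialise_swap G' ℓ₀ ℓ₁ hℓ]
    rw [heq]
    have hg : ∀ j : {x : Fin r // ¬ β x = false}, grp (f j) = true := by
      intro j
      have := hf j
      rw [bool_eq_true_of_not_eq_false j.2] at this
      exact this.symm
    exact det_block_ne_zero (ι := {x : Fin r // ¬ β x = false}) G' ℓ₁ ℓ₀ S P w
      (fun i => R i) (fun j => C (f j)) (fun i => pos i) (fun j => qφ (f j))
      (fun i => hpos₁ i i.2) (fun i a ha => (huniq i a ha).2) (fun i => havoid₁ i i.2)
      (fun j => (hφ₁ (f j) (hg j)).2.1) (fun j => (hφ₁ (f j) (hg j)).2.2) h₁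
  have hLp : Lp.det ≠ 0 := by
    intro h0
    have := hperm h0
    rw [hblock] at this
    exact mul_ne_zero hB₀ hB₁ this
  -- (4) evaluate
  obtain ⟨t, ht⟩ := exists_eval_ne_zero_of_ne_zero _ hLp
  refine ⟨Gp.map (Polynomial.eval t), ?_⟩
  have hev : (Matrix.of fun i j : Fin r => ((Gp.map (Polynomial.eval t)).submatrix (R i) (C j)).det)
      = (Polynomial.evalRingHom t).mapMatrix Lp := by
    ext i j
    have h1 : ((Polynomial.evalRingHom t).mapMatrix Lp) i j
        = Polynomial.evalRingHom t ((Gp.submatrix (R i) (C j)).det) := by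
      simp only [RingHom.mapMatrix_apply, Matrix.map_apply, hLp_def, Matrix.of_apply]
    rw [h1, RingHom.map_det, RingHom.mapMatrix_apply, Matrix.of_apply, ← Matrix.submatrix_map]
    rfl
  rw [hev, ← RingHom.map_det]
  exact ht

end PairMove

end Summit.ValiantsHypothesis.ValiantsHypothesis.Theorems.BarrierLever.PriorityPeeling
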